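/-
Copyright (c) 2026. All rights reserved.
Released under Apache 2.0 license as described in the file LICENSE.
-/
import Literature.MathematicalPhysics.QuantumFieldTheory.Balaban1983to89.B4Lemma22ConstRows

/-!
# B4 Lemma 2.2 (2.17), `q = p = 1`, SECOND MEMBER `D^η_{Ã,μ}G_k(□,Ã)` (AND, BY DUALITY, THE THIRD MEMBER
`G_k(□,Ã)D^{η*}_{Ã,μ}` AT `q = p = ∞`) — THE `ℓ¹` FIRST-ORDER SMALLNESS OF `V_k`

[B4] = T. Bałaban, *(Higgs)₂,₃ quantum fields in a finite volume. III. Regularity and decay of lattice Green's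
functions*, Commun. Math. Phys. **89** (1983) 571–597 (bib key `Balaban1983RegularityDecay`).

## The printed step («» = quotation units, transcript-B4.md ll. 104–110, 131–133, 159–166, 187)

Lemma 2.2, pp. 577–578: «and a constant c₂ depending on d, p₁, such that (2.17) ‖G_k(□,Ã)f‖_q,
‖D^η_{Ã,μ}G_k(□,Ã)f‖_q, ‖G_k(□,Ã)D^{η*}_{Ã,μ}f‖_q ≤ c₂‖f‖_p for 1 ≤ p, q ≤ ∞, satisfying the condition
1/p − 1/p₁ ≤ 1/q ≤ 1/p with p₁ > d.»  Proof, p. 579 (2.23): «A = A₀ + A', |A'|, |∂^η_μA'| ≤ c'e^{β−1},»;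
p. 581: «At first let us observe that V_k can be interpreted as a first order differential operator acting on a
function on the right hand side of it.» … «Thus it is a first order differential operator with small
coefficients.» … «Now using Lemma 2.2 for G_k(□,A₀) and the decomposition D^η_Ã = U(A')D^η_{A₀} + F_{1,k}(A'), we
have» (2.33) … «The inequality (2.17) is proved in the same way.»; p. 583: «For q = p = 1 we get it by duality
argument, i.e. using the fact that the space L^∞(□) is adjoint to L¹(□).»

## What this file certifies (kernel form; the lineage's typed objects)

The tree proves (2.17) for the lineage's `G_k(□,Ã)` (`B4Lemma22ReduceZero.greenA` at `Ã = constBond A₀ + A'`,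
boxes, staircase contours) in the row `q = p = ∞` for the members `G`, `D^η_{Ã,μ}G` (`B4Lemma22SupStair`) and in
the row `q = p = 1` for the members `G`, `G D^{η*}_{Ã,μ}` (`B4Lemma22DualL1`, by transposition).  The remaining
`n ≤ 1` entry of the two extreme rows — `‖D^η_{Ã,μ}G_k(□,Ã)f‖₁ ≤ c‖f‖₁`, equivalently (transpose, `Gᵀ = G`)
`‖G_k(□,Ã)D^{η*}_{Ã,μ}f‖_∞ ≤ c‖f‖_∞` — needs the p. 581 bootstrap (2.31)–(2.33) run in the norm `‖·‖₁` itself,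
i.e. the `ℓ¹` form of «V_k can be interpreted as a first order differential operator» with small coefficients.
The abstract engine `B4Lemma22Reduce231.bootstrap/deriv_convert/bootstrap_dual` accepts any subadditive `ν`; the
constant-`A₀` `ℓ¹` input is `B4Lemma22ConstRows.const_box_l1`; the `ℓ¹` conversion `D_Ã ↔ D_{A₀}` is
`B4Lemma22ReduceDeriv.covDeriv_sub_l1N_le`.  This file supplies the missing piece and assembles:
* §1 `ℓ¹` norm algebra (`l1N_neg`, `l1N_smul`, `l1N_le_of_site`) and first-order smallness for a general `ν`;
* §2 the SITEWISE form of the pieces of `V_k` with the covariant derivative kept LOCAL (`bondSum_site`: a bond sum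
  `Σ_y c(z,y)K_y(W₀(z,y)u(y) − u(z))` is `≤ (n/2)ρ·Σ_μ(|D_μu(z)| + |D_μu(z − e_μ)|)`, by `bond_fwd`/`bond_bwd` and
  the regrouping `B4Lemma22CrossSup.sum_box_nbrs`), summed over sites with the shift reindexing `sum_dite_shift_le`
  (each site is the backward neighbour of at most one site): `‖Cᵀu‖₁ ≤ ℓθΣ_μ‖D_μu‖₁` (`crossT_l1`),
  `‖Cu‖₁ ≤ ℓθΣ_μ‖D_μu‖₁ + (d+1)ℓθ'‖u‖₁` (`cross_l1`, zeroth part from `B4Lemma22CrossSup.cross_zeroth_le`),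
  `‖F₁^*F₁u‖₁ ≤ (d+1)ℓ²θ²‖u‖₁` (`quad_l1`), and the `a`-terms `‖a_kn^{-(d+1)}(F₂^*Q₀ + Q₀^*F₂ + F₂^*F₂)u‖₁ ≤
  a_kℓτ(2+ℓτ)‖u‖₁` (`aterm_l1N_le'`: block COLUMN sums `≤ 1` for `Q₀, F₂`, block ROW sums `≤ n^{d+1}` for their
  transposes — the roles of `B4Lower18Regular.sum_blkWt_row/col` are swapped relative to the sup row);
* §3 `firstOrderSmall_pertV_l1`: `V_k` is first-order small in `‖·‖₁` relative to `(D^η_{A₀,μ})_μ` with constant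
  `2ℓθ + (d+1)ℓθ' + (d+1)ℓ²θ² + a_kℓτ(2+ℓτ)` (`≤` the sup-row constant of `B4Lemma22CrossSup.lemma22_17_sup_box`);
* §4 `lemma22_17_l1_box`: on a fine box with an arbitrary contour system ending at the averaged point, under the
  SAME hypotheses as `B4Lemma22CrossSup.lemma22_17_sup_box`: `‖Gf‖₁ + Σ_μ‖D^η_{A₀,μ}Gf‖₁ ≤ 2(d+2)c‖f‖₁`,
  `‖D^η_{Ã,μ}Gf‖₁ ≤ (1+ℓθ)2(d+2)c‖f‖₁`, and by duality (`bootstrap_dual`, `supN_transpose_le`, `b4Green_transpose`)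
  `‖G(D^η_{A₀,μ})ᵀf‖_∞ ≤ 2(d+2)c‖f‖_∞`, `‖G(D^η_{Ã,μ})ᵀf‖_∞ ≤ (1+ℓθ)2(d+2)c‖f‖_∞`;
* §5 `lemma22_17_l1_deriv_stair`: the staircase specialisation with invertibility (`green_box_l2_bound`), `hend`
  (`stairContour_end`) and `τ = (d+1)θ` (`stair_lsum_le`) discharged, exactly as in `B4Lemma22SupStair`.
With `B4Lemma22SupStair.lemma22_17_sup_stair` and `B4Lemma22DualL1.lemma22_17_l1_stair` this completes ALL THREE
members `n ≤ 1` of (2.17) in BOTH extreme rows `q = p = ∞`, `q = p = 1` for `G_k(□,Ã)` on boxes with staircase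
contours, every operator-side hypothesis discharged inside the lineage.

## Honest scope

(a) Boxes `Π[0,(ℓ+1)^kM_μ)` and (in §5) the lineage's staircase contours only; no torus, no general region, no link
`Ã ↔` the torus configuration of pp. 575–576.  (b) The hypotheses are the (2.23)-TYPE bounds with FREE parameters
`θ` (bond size `|κA'_b| ≤ θ/n`), `θ'` (discrete derivative `|κ(A'(b') − A'(b))| ≤ θ'/n²`), `τ` (contour sums; `(d+1)θ`
in §5) and the boundary condition "`A' = 0` on the `μ`-bonds touching the `μ`-faces" («A' is regular and has a
compact support in □»), plus explicit smallness inequalities («for e sufficiently small»; in [B4] `θ, θ' = O(e^βc)`):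
their provenance from (1.7) for the fields `Ã_j` of (2.8)–(2.10) is NOT certified here.  (c) Constants explicit, not
optimised; only `n ≤ 1` members; the interior of the `(p,q)` range (Riesz–Thorin) and (2.16) are not touched.
(d) Value = kernel certificate of printed inference steps, NOT summit progress.  No manuscript step is used as a
hypothesis of a theorem claiming a printed conclusion; 0 cited facts; every theorem is proved from the lineage's
definitions.
-/

namespace Literature.MathematicalPhysics.QuantumFieldTheory.Balaban1983to89.B4Lemma22L1Stair

open Finset Matrix
open Literature.MathematicalPhysics.QuantumFieldTheory.Balaban1983to89.B4GaugeCovariance (fld fld_apply OrthFlow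
  fieldLink avgOp fld_avgOp_mulVec boxWt blkWt constBond contourTrans pathEnd sum_boxWt_right)
open Literature.MathematicalPhysics.QuantumFieldTheory.Balaban1983to89.B4Lower18Regular (e1 kmul kmul_apply pertE
  pertT crossOp quadOp pertF vOp lsum sum_blkWt_row sum_blkWt_col baseEmb stairContour stairContour_end
  green_box_l2_bound)
open Literature.MathematicalPhysics.QuantumFieldTheory.Balaban1983to89.B4Lemma21Region (siteNorm covDeriv)
open Literature.MathematicalPhysics.QuantumFieldTheory.Balaban1983to89.B4Reflection242 (nbrs boxDom nbrs_comm)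
open Literature.MathematicalPhysics.QuantumFieldTheory.Balaban1983to89.B4Lemma22Reduce231
open Literature.MathematicalPhysics.QuantumFieldTheory.Balaban1983to89.B4Lemma22ReduceZero (siteNorm_sum_le Box
  greenA greenA0 opA pertV derivA derivA0 greenA_resolvent card_dir_add_one)
open Literature.MathematicalPhysics.QuantumFieldTheory.Balaban1983to89.B4Lemma22ReduceDeriv (siteNorm_flow_sub_one_le
  siteNorm_flow add_e1_mem_nbrs covDeriv_sub_l1N_le)
open Literature.MathematicalPhysics.QuantumFieldTheory.Balaban1983to89.B4Lemma22PertVSup (siteNorm_neg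
  fld_crossOp_transpose_mulVec fld_quadOp_mulVec pertE_mulVec_le pertE_transpose_mulVec_le constBond_antisymm
  boxWt_nonneg bond_fwd bond_bwd card_nbrs_filter_le blkWt_nonneg contourTrans_fieldLink fld_avgOp_transpose_mulVec)
open Literature.MathematicalPhysics.QuantumFieldTheory.Balaban1983to89.B4Lemma22CrossSup (cross_site_eq sum_box_nbrs
  cross_zeroth_le lemma22_17_sup_box)
open Literature.MathematicalPhysics.QuantumFieldTheory.Balaban1983to89.B4Lemma22SupStair (stair_lsum_le)
open Literature.MathematicalPhysics.QuantumFieldTheory.Balaban1983to89.B4Lemma22DualL1 (b4Green_transpose)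
open Literature.MathematicalPhysics.QuantumFieldTheory.Balaban1983to89.B4Lemma22ConstRows (const_box_l1)

noncomputable section

variable {ι : Type} [Fintype ι] [DecidableEq ι]

/-! ## §1 `ℓ¹` norm algebra; first-order smallness for a general norm functional -/

section General

variable {X : Type*} [Fintype X]

omit [DecidableEq ι] in
/-- `‖−Φ‖₁ = ‖Φ‖₁`. [folklore] -/
theorem l1N_neg (Φ : X × ι → ℝ) : l1N (-Φ) = l1N Φ := by
  unfold l1N
  refine sum_congr rfl fun x _ => ?_
  exact siteNorm_neg (fld Φ x)

omit [DecidableEq ι] in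
/-- `‖r • Φ‖₁ = |r|·‖Φ‖₁`. [folklore] -/
theorem l1N_smul (r : ℝ) (Φ : X × ι → ℝ) : l1N (r • Φ) = |r| * l1N Φ := by
  unfold l1N
  rw [mul_sum]
  refine sum_congr rfl fun x _ => ?_
  have : fld (r • Φ) x = r • fld Φ x := rfl
  rw [this, siteNorm_smul]

omit [DecidableEq ι] in
/-- **`ℓ¹` BOUND FROM A SITEWISE KERNEL BOUND**: if `|ψ(y)| ≤ Σ_x k(y,x)|u(x)|` for all `y` and the COLUMN sums
`Σ_y k(y,x) ≤ B`, then `‖Ψ‖₁ ≤ B‖u‖₁` (swap the sums). [folklore] -/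
theorem l1N_le_of_site {Y : Type*} [Fintype Y] (Ψ : Y × ι → ℝ) (u : X × ι → ℝ) (k : Y → X → ℝ)
    (h : ∀ y, siteNorm (fld Ψ y) ≤ ∑ x, k y x * siteNorm (fld u x)) {B : ℝ} (hB : ∀ x, ∑ y, k y x ≤ B) :
    l1N Ψ ≤ B * l1N u := by
  unfold l1N
  calc ∑ y, siteNorm (fld Ψ y) ≤ ∑ y, ∑ x, k y x * siteNorm (fld u x) := sum_le_sum fun y _ => h y
    _ = ∑ x, (∑ y, k y x) * siteNorm (fld u x) := by
        rw [sum_comm]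
        exact sum_congr rfl fun x _ => (sum_mul _ _ _).symm
    _ ≤ ∑ x, B * siteNorm (fld u x) :=
        sum_le_sum fun x _ => mul_le_mul_of_nonneg_right (hB x) (siteNorm_nonneg _)
    _ = B * ∑ x, siteNorm (fld u x) := by rw [mul_sum]

variable {K : Type*} [Fintype K] {ν : (X × ι → ℝ) → ℝ}

omit [DecidableEq ι] in
/-- first-order smallness is ADDITIVE in the operator, for any subadditive `ν`. [folklore] -/
theorem firstOrderSmall_add' (hνadd : ∀ a b, ν (a + b) ≤ ν a + ν b) {V₁ V₂ : Matrix (X × ι) (X × ι) ℝ}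
    {D : K → Matrix (X × ι) (X × ι) ℝ} {ε₁ ε₂ : ℝ} (h₁ : FirstOrderSmall ν V₁ D ε₁)
    (h₂ : FirstOrderSmall ν V₂ D ε₂) : FirstOrderSmall ν (V₁ + V₂) D (ε₁ + ε₂) := by
  intro u
  rw [add_mulVec, add_mul]
  exact (hνadd _ _).trans (add_le_add (h₁ u) (h₂ u))

omit [DecidableEq ι] in
/-- first-order smallness of `−V`, for any `ν` with `ν(−a) = ν(a)`. [folklore] -/
theorem firstOrderSmall_neg' (hνneg : ∀ a, ν (-a) = ν a) {V : Matrix (X × ι) (X × ι) ℝ}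
    {D : K → Matrix (X × ι) (X × ι) ℝ} {ε : ℝ} (h : FirstOrderSmall ν V D ε) : FirstOrderSmall ν (-V) D ε := by
  intro u
  rw [neg_mulVec, hνneg]
  exact h u

omit [DecidableEq ι] in
/-- a bound `ν(Vu) ≤ ε₁Σ_μν(D_μu) + ε₀ν(u)` (first- plus zeroth-order part) gives first-order smallness with constant
`ε₁ + ε₀`, for any nonnegative `ν`. [folklore] -/
theorem firstOrderSmall_of_le' (hν0 : ∀ a, 0 ≤ ν a) {V : Matrix (X × ι) (X × ι) ℝ}
    {D : K → Matrix (X × ι) (X × ι) ℝ} {ε₀ ε₁ : ℝ} (hε₀ : 0 ≤ ε₀) (hε₁ : 0 ≤ ε₁)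
    (h : ∀ u, ν (V *ᵥ u) ≤ ε₁ * ∑ μ, ν (D μ *ᵥ u) + ε₀ * ν u) : FirstOrderSmall ν V D (ε₁ + ε₀) := by
  intro u
  have hu := hν0 u
  have hS : 0 ≤ ∑ μ, ν (D μ *ᵥ u) := sum_nonneg fun μ _ => hν0 _
  have h1 := mul_nonneg hε₁ hu
  have h2 := mul_nonneg hε₀ hS
  have e : (ε₁ + ε₀) * (ν u + ∑ μ, ν (D μ *ᵥ u))
      = ε₁ * ∑ μ, ν (D μ *ᵥ u) + ε₀ * ν u + (ε₁ * ν u + ε₀ * ∑ μ, ν (D μ *ᵥ u)) := by ring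
  refine (h u).trans ?_
  rw [e]
  linarith

omit [DecidableEq ι] in
/-- a ZEROTH-ORDER bound `ν(Vu) ≤ εν(u)` gives first-order smallness, for any nonnegative `ν`. [folklore] -/
theorem firstOrderSmall_of_zeroth' (hν0 : ∀ a, 0 ≤ ν a) {V : Matrix (X × ι) (X × ι) ℝ}
    (D : K → Matrix (X × ι) (X × ι) ℝ) {ε : ℝ} (hε : 0 ≤ ε) (h : ∀ u, ν (V *ᵥ u) ≤ ε * ν u) :
    FirstOrderSmall ν V D ε := by
  have key := firstOrderSmall_of_le' (D := D) hν0 hε le_rfl (ε₁ := 0) fun u => by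
    rw [zero_mul, zero_add]; exact h u
  rwa [zero_add] at key

omit [DecidableEq ι] in
/-- monotonicity in the constant, for any nonnegative `ν`. [folklore] -/
theorem firstOrderSmall_mono' (hν0 : ∀ a, 0 ≤ ν a) {V : Matrix (X × ι) (X × ι) ℝ}
    {D : K → Matrix (X × ι) (X × ι) ℝ} {ε ε' : ℝ} (h : FirstOrderSmall ν V D ε) (hε : ε ≤ ε') :
    FirstOrderSmall ν V D ε' := by
  intro u
  refine (h u).trans (mul_le_mul_of_nonneg_right hε ?_)
  exact add_nonneg (hν0 u) (sum_nonneg fun μ _ => hν0 _)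

end General

/-! ## §2 The pieces of `V_k` sitewise with LOCAL covariant derivatives, and their `ℓ¹` bounds -/

section Box

variable {d : ℕ}

omit [DecidableEq ι] in
/-- **SHIFT REINDEXING**: for an injective map `s` of the lattice and `g ≥ 0` on a finite region `R`,
`Σ_{z ∈ R} [s(z) ∈ R]·g(s(z)) ≤ Σ_{y ∈ R} g(y)` (each `y` is `s(z)` for at most one `z`). [folklore] -/
theorem sum_dite_shift_le {R : Finset (Fin (d + 1) → ℤ)} {s : (Fin (d + 1) → ℤ) → (Fin (d + 1) → ℤ)}
    (hs : Function.Injective s) (g : ↥R → ℝ) (hg : ∀ y, 0 ≤ g y) :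
    ∑ z : ↥R, (if h : s z.1 ∈ R then g ⟨s z.1, h⟩ else 0) ≤ ∑ y, g y := by
  classical
  have hz : ∀ z : ↥R, (if h : s z.1 ∈ R then g ⟨s z.1, h⟩ else 0)
      = ∑ y : ↥R, if y.1 = s z.1 then g y else 0 := by
    intro z
    by_cases h : s z.1 ∈ R
    · rw [dif_pos h, Finset.sum_eq_single ⟨s z.1, h⟩]
      · rw [if_pos rfl]
      · intro y _ hy
        rw [if_neg]
        intro hy1
        exact hy (Subtype.ext hy1)
      · intro hh; exact absurd (Finset.mem_univ _) hh
    · rw [dif_neg h]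
      symm
      refine Finset.sum_eq_zero fun y _ => ?_
      rw [if_neg]
      intro hy
      exact h (hy ▸ y.2)
  simp_rw [hz]
  rw [Finset.sum_comm]
  refine Finset.sum_le_sum fun y _ => ?_
  calc ∑ z : ↥R, (if y.1 = s z.1 then g y else 0)
      = ∑ z ∈ (Finset.univ.filter fun z : ↥R => y.1 = s z.1), g y := by rw [Finset.sum_filter]
    _ ≤ g y := by
        rw [Finset.sum_const, nsmul_eq_mul]
        have hcard : ((Finset.univ.filter fun z : ↥R => y.1 = s z.1).card : ℝ) ≤ 1 := by
          have : (Finset.univ.filter fun z : ↥R => y.1 = s z.1).card ≤ 1 := by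
            refine Finset.card_le_one.2 fun a ha b hb => ?_
            rw [Finset.mem_filter] at ha hb
            exact Subtype.ext (hs (ha.2.symm.trans hb.2))
          exact_mod_cast this
        nlinarith [hg y]

omit [DecidableEq ι] in
/-- summing the local derivative sizes `|D_μu(z)| + [z − e_μ ∈ R]·|D_μu(z − e_μ)|` over sites and directions gives at
most `2Σ_μ‖D_μu‖₁`. [folklore] -/
theorem sum_dirs_le {R : Finset (Fin (d + 1) → ℤ)} (Φ : Fin (d + 1) → ↥R × ι → ℝ) :
    ∑ z : ↥R, ∑ μ, (siteNorm (fld (Φ μ) z)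
        + (if h : z.1 - e1 μ ∈ R then siteNorm (fld (Φ μ) ⟨z.1 - e1 μ, h⟩) else 0))
      ≤ 2 * ∑ μ, l1N (Φ μ) := by
  rw [Finset.sum_comm, Finset.mul_sum]
  refine sum_le_sum fun μ _ => ?_
  rw [sum_add_distrib, two_mul]
  unfold l1N
  refine add_le_add le_rfl ?_
  exact sum_dite_shift_le (s := fun w => w - e1 μ) sub_left_injective (fun y => siteNorm (fld (Φ μ) y))
    fun y => siteNorm_nonneg _

/-- **A BOND SUM WITH LOCAL DERIVATIVES** (the common shape of `Cᵀu` and of the covariant-difference part of `Cu`):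
for [B4]'s weights `c(z,y) = (n²/2)·1[|z−y|=1]`, orthogonal links `W₀ = U(κA₀)` of an antisymmetric `A₀`, and site
matrices `K_y` with `|K_yv| ≤ ρ|v|` for `y ∈ nbrs z`:
`|Σ_y c(z,y)K_y(W₀(z,y)u(y) − u(z))| ≤ (n/2)ρ·Σ_μ(|D_μu(z)| + [z−e_μ ∈ □]|D_μu(z−e_μ)|)` (`bond_fwd`: the forward
bond difference is `ηD_μu(z)`; `bond_bwd`: the backward one is `−W₀·ηD_μu(z−e_μ)`).
[cite: Balaban1983RegularityDecay, p. 581 (2.32); p. 572 (1.3)] -/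
theorem bondSum_site (F : OrthFlow ι) (κ : ℝ) {n : ℕ} (hn : 1 ≤ n) (N : Fin (d + 1) → ℕ)
    (A₀ : ↥(boxDom N) → ↥(boxDom N) → ℝ) (hanti : ∀ x y, A₀ y x = -A₀ x y) (z : ↥(boxDom N))
    {K : ↥(boxDom N) → Matrix ι ι ℝ} {ρ : ℝ} (hρ : 0 ≤ ρ)
    (hK : ∀ y, y.1 ∈ nbrs z.1 → ∀ v, siteNorm (K y *ᵥ v) ≤ ρ * siteNorm v) (u : ↥(boxDom N) × ι → ℝ) :
    siteNorm (∑ y, boxWt n N z y • (K y *ᵥ (fieldLink F κ A₀ z y *ᵥ fld u y - fld u z)))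
      ≤ (n : ℝ) / 2 * ρ * ∑ μ, (siteNorm (fld (covDeriv n (boxDom N) (fieldLink F κ A₀) μ *ᵥ u) z)
          + (if h : z.1 - e1 μ ∈ boxDom N then
              siteNorm (fld (covDeriv n (boxDom N) (fieldLink F κ A₀) μ *ᵥ u) ⟨z.1 - e1 μ, h⟩) else 0)) := by
  have hn0 : (0 : ℝ) < n := by exact_mod_cast hn
  have hw : ∀ y, boxWt n N z y • (K y *ᵥ (fieldLink F κ A₀ z y *ᵥ fld u y - fld u z))
      = ((n : ℝ) ^ 2 / 2) • (if y.1 ∈ nbrs z.1 then K y *ᵥ (fieldLink F κ A₀ z y *ᵥ fld u y - fld u z)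
          else 0) := by
    intro y
    unfold boxWt
    split_ifs <;> simp
  simp_rw [hw]
  rw [← Finset.smul_sum, sum_box_nbrs N z (fun y => K y *ᵥ (fieldLink F κ A₀ z y *ᵥ fld u y - fld u z)),
    siteNorm_smul, abs_of_nonneg (by positivity)]
  -- the forward bond `z → z + e_μ`
  have hfwd : ∀ μ, siteNorm (if h : z.1 + e1 μ ∈ boxDom N then
      K ⟨z.1 + e1 μ, h⟩ *ᵥ (fieldLink F κ A₀ z ⟨z.1 + e1 μ, h⟩ *ᵥ fld u ⟨z.1 + e1 μ, h⟩ - fld u z) else 0)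
      ≤ ρ * ((n : ℝ)⁻¹ * siteNorm (fld (covDeriv n (boxDom N) (fieldLink F κ A₀) μ *ᵥ u) z)) := by
    intro μ
    by_cases h : z.1 + e1 μ ∈ boxDom N
    · rw [dif_pos h]
      have hy : (⟨z.1 + e1 μ, h⟩ : ↥(boxDom N)).1 ∈ nbrs z.1 := add_e1_mem_nbrs z.1 μ
      refine (hK _ hy _).trans (mul_le_mul_of_nonneg_left (le_of_eq ?_) hρ)
      rw [bond_fwd hn (fieldLink F κ A₀) μ u rfl, siteNorm_smul, abs_of_nonneg (inv_nonneg.2 hn0.le)]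
    · rw [dif_neg h, siteNorm_zero]
      exact mul_nonneg hρ (mul_nonneg (inv_nonneg.2 hn0.le) (siteNorm_nonneg _))
  -- the backward bond `z → z − e_μ`
  have hbwd : ∀ μ, siteNorm (if h : z.1 - e1 μ ∈ boxDom N then
      K ⟨z.1 - e1 μ, h⟩ *ᵥ (fieldLink F κ A₀ z ⟨z.1 - e1 μ, h⟩ *ᵥ fld u ⟨z.1 - e1 μ, h⟩ - fld u z) else 0)
      ≤ ρ * ((n : ℝ)⁻¹ * (if h : z.1 - e1 μ ∈ boxDom N then
          siteNorm (fld (covDeriv n (boxDom N) (fieldLink F κ A₀) μ *ᵥ u) ⟨z.1 - e1 μ, h⟩) else 0)) := by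
    intro μ
    by_cases h : z.1 - e1 μ ∈ boxDom N
    · rw [dif_pos h, dif_pos h]
      have hy : (⟨z.1 - e1 μ, h⟩ : ↥(boxDom N)).1 ∈ nbrs z.1 := by
        have h1 := add_e1_mem_nbrs (z.1 - e1 μ) μ
        rw [sub_add_cancel] at h1
        exact nbrs_comm.1 h1
      have hz : z.1 = (⟨z.1 - e1 μ, h⟩ : ↥(boxDom N)).1 + e1 μ := (sub_add_cancel _ _).symm
      refine (hK _ hy _).trans (mul_le_mul_of_nonneg_left (le_of_eq ?_) hρ)
      rw [bond_bwd F κ hn A₀ hanti μ u hz, siteNorm_neg]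
      have : siteNorm (fieldLink F κ A₀ z ⟨z.1 - e1 μ, h⟩
          *ᵥ (((n : ℝ)⁻¹) • fld (covDeriv n (boxDom N) (fieldLink F κ A₀) μ *ᵥ u) ⟨z.1 - e1 μ, h⟩))
          = siteNorm (((n : ℝ)⁻¹) • fld (covDeriv n (boxDom N) (fieldLink F κ A₀) μ *ᵥ u) ⟨z.1 - e1 μ, h⟩) :=
        siteNorm_flow F _ _
      rw [this, siteNorm_smul, abs_of_nonneg (inv_nonneg.2 hn0.le)]
    · rw [dif_neg h, dif_neg h, siteNorm_zero, mul_zero, mul_zero]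
  calc (n : ℝ) ^ 2 / 2 * siteNorm (∑ μ, ((if h : z.1 + e1 μ ∈ boxDom N then
          K ⟨z.1 + e1 μ, h⟩ *ᵥ (fieldLink F κ A₀ z ⟨z.1 + e1 μ, h⟩ *ᵥ fld u ⟨z.1 + e1 μ, h⟩ - fld u z) else 0)
          + (if h : z.1 - e1 μ ∈ boxDom N then
          K ⟨z.1 - e1 μ, h⟩ *ᵥ (fieldLink F κ A₀ z ⟨z.1 - e1 μ, h⟩ *ᵥ fld u ⟨z.1 - e1 μ, h⟩ - fld u z) else 0)))
      ≤ (n : ℝ) ^ 2 / 2 * ∑ μ, (ρ * ((n : ℝ)⁻¹ * siteNorm (fld (covDeriv n (boxDom N) (fieldLink F κ A₀) μ *ᵥ u) z))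
          + ρ * ((n : ℝ)⁻¹ * (if h : z.1 - e1 μ ∈ boxDom N then
              siteNorm (fld (covDeriv n (boxDom N) (fieldLink F κ A₀) μ *ᵥ u) ⟨z.1 - e1 μ, h⟩) else 0))) := by
        refine mul_le_mul_of_nonneg_left ?_ (by positivity)
        refine (siteNorm_sum_le _ _).trans (sum_le_sum fun μ _ => ?_)
        exact (siteNorm_add_le _ _).trans (add_le_add (hfwd μ) (hbwd μ))
    _ = (n : ℝ) / 2 * ρ * ∑ μ, (siteNorm (fld (covDeriv n (boxDom N) (fieldLink F κ A₀) μ *ᵥ u) z)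
          + (if h : z.1 - e1 μ ∈ boxDom N then
              siteNorm (fld (covDeriv n (boxDom N) (fieldLink F κ A₀) μ *ᵥ u) ⟨z.1 - e1 μ, h⟩) else 0)) := by
        rw [mul_sum, mul_sum]
        refine sum_congr rfl fun μ _ => ?_
        have hn1 : (n : ℝ) ≠ 0 := hn0.ne'
        field_simp

/-- **`‖Cᵀu‖₁ ≤ ℓθ·Σ_μ‖D^η_{A₀,μ}u‖₁`** — the field-side cross term «F_{1,k}(−A')^*D^η_{A₀}» is first-order small
in `‖·‖₁`, under `|κA'_b| ≤ θ/n` on nearest-neighbour bonds. [cite: Balaban1983RegularityDecay, p. 581 (2.32)] -/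
theorem crossT_l1 (F : OrthFlow ι) {ℓ : ℝ} (hℓ : 0 ≤ ℓ)
    (hLip : ∀ t (v : ι → ℝ), ((F.U t - 1) *ᵥ v) ⬝ᵥ ((F.U t - 1) *ᵥ v) ≤ (ℓ * t) ^ 2 * (v ⬝ᵥ v))
    (κ : ℝ) {n : ℕ} (hn : 1 ≤ n) (N : Fin (d + 1) → ℕ) (A₀ : ↥(boxDom N) → ↥(boxDom N) → ℝ)
    (hanti : ∀ x y, A₀ y x = -A₀ x y) {A' : ↥(boxDom N) → ↥(boxDom N) → ℝ} {θ : ℝ} (hθ : 0 ≤ θ)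
    (hA' : ∀ x y, y.1 ∈ nbrs x.1 → |κ * A' x y| ≤ θ / n) (u : ↥(boxDom N) × ι → ℝ) :
    l1N ((crossOp (boxWt n N) (fieldLink F κ A₀) (pertE (fieldLink F κ A')))ᵀ *ᵥ u)
      ≤ ℓ * θ * ∑ μ, l1N (covDeriv n (boxDom N) (fieldLink F κ A₀) μ *ᵥ u) := by
  have hn0 : (0 : ℝ) < n := by exact_mod_cast hn
  have hρ : 0 ≤ ℓ * (θ / n) := mul_nonneg hℓ (div_nonneg hθ hn0.le)
  have hsite : ∀ z, siteNorm (fld ((crossOp (boxWt n N) (fieldLink F κ A₀) (pertE (fieldLink F κ A')))ᵀ *ᵥ u) z)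
      ≤ (n : ℝ) / 2 * (ℓ * (θ / n)) * ∑ μ, (siteNorm (fld (covDeriv n (boxDom N) (fieldLink F κ A₀) μ *ᵥ u) z)
          + (if h : z.1 - e1 μ ∈ boxDom N then
              siteNorm (fld (covDeriv n (boxDom N) (fieldLink F κ A₀) μ *ᵥ u) ⟨z.1 - e1 μ, h⟩) else 0)) := by
    intro z
    rw [fld_crossOp_transpose_mulVec]
    refine bondSum_site F κ hn N A₀ hanti z hρ (fun y hy v => ?_) u
    exact (pertE_transpose_mulVec_le F hℓ hLip κ A' z y v).trans
      (mul_le_mul_of_nonneg_right (mul_le_mul_of_nonneg_left (hA' z y hy) hℓ) (siteNorm_nonneg _))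
  unfold l1N
  refine (sum_le_sum fun z _ => hsite z).trans ?_
  rw [← mul_sum]
  refine (mul_le_mul_of_nonneg_left (sum_dirs_le _) (by positivity)).trans (le_of_eq ?_)
  unfold l1N
  field_simp

/-- **`‖Cu‖₁ ≤ ℓθ·Σ_μ‖D^η_{A₀,μ}u‖₁ + (d+1)ℓθ'·‖u‖₁`** — the divergence-form cross term «D^{η*}_{A₀}F_{1,k}(−A')»
in `‖·‖₁`: its covariant-difference part by `bondSum_site`, its divergence part sitewise by
`B4Lemma22CrossSup.cross_zeroth_le` (derivative bound `θ'/n²` on consecutive parallel bonds, `A' = 0` on the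
`μ`-bonds touching the `μ`-faces). [cite: Balaban1983RegularityDecay, p. 581 (2.32)] -/
theorem cross_l1 (F : OrthFlow ι) {ℓ : ℝ} (hℓ : 0 ≤ ℓ)
    (hLip : ∀ t (v : ι → ℝ), ((F.U t - 1) *ᵥ v) ⬝ᵥ ((F.U t - 1) *ᵥ v) ≤ (ℓ * t) ^ 2 * (v ⬝ᵥ v))
    (κ : ℝ) {n : ℕ} (hn : 1 ≤ n) (N : Fin (d + 1) → ℕ) (A₀ : ↥(boxDom N) → ↥(boxDom N) → ℝ)
    (hanti : ∀ x y, A₀ y x = -A₀ x y) {A' : ↥(boxDom N) → ↥(boxDom N) → ℝ} {θ θ' : ℝ} (hθ : 0 ≤ θ)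
    (hA' : ∀ x y, y.1 ∈ nbrs x.1 → |κ * A' x y| ≤ θ / n) (hθ' : 0 ≤ θ')
    (hder : ∀ (x z y : ↥(boxDom N)) (μ : Fin (d + 1)), z.1 = x.1 + e1 μ → y.1 = z.1 + e1 μ →
      |κ * (A' y z - A' z x)| ≤ θ' / (n : ℝ) ^ 2 ∧ |κ * (A' x z - A' z y)| ≤ θ' / (n : ℝ) ^ 2)
    (hbd : ∀ (x y : ↥(boxDom N)) (μ : Fin (d + 1)), y.1 = x.1 + e1 μ →
      (x.1 - e1 μ ∉ boxDom N ∨ y.1 + e1 μ ∉ boxDom N) → A' x y = 0 ∧ A' y x = 0)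
    (u : ↥(boxDom N) × ι → ℝ) :
    l1N (crossOp (boxWt n N) (fieldLink F κ A₀) (pertE (fieldLink F κ A')) *ᵥ u)
      ≤ ℓ * θ * ∑ μ, l1N (covDeriv n (boxDom N) (fieldLink F κ A₀) μ *ᵥ u) + ((d : ℝ) + 1) * ℓ * θ' * l1N u := by
  have hn0 : (0 : ℝ) < n := by exact_mod_cast hn
  have hρ : 0 ≤ ℓ * (θ / n) := mul_nonneg hℓ (div_nonneg hθ hn0.le)
  have hsite : ∀ z, siteNorm (fld (crossOp (boxWt n N) (fieldLink F κ A₀) (pertE (fieldLink F κ A')) *ᵥ u) z)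
      ≤ (n : ℝ) / 2 * (ℓ * (θ / n)) * ∑ μ, (siteNorm (fld (covDeriv n (boxDom N) (fieldLink F κ A₀) μ *ᵥ u) z)
          + (if h : z.1 - e1 μ ∈ boxDom N then
              siteNorm (fld (covDeriv n (boxDom N) (fieldLink F κ A₀) μ *ᵥ u) ⟨z.1 - e1 μ, h⟩) else 0))
        + ((d : ℝ) + 1) * ℓ * θ' * siteNorm (fld u z) := by
    intro z
    rw [cross_site_eq F κ n N A₀ hanti A' u z]
    refine (siteNorm_add_le _ _).trans (add_le_add ?_ (cross_zeroth_le F hℓ hLip κ hn N hθ' hder hbd u z))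
    refine bondSum_site F κ hn N A₀ hanti z hρ (fun y hy v => ?_) u
    exact (pertE_mulVec_le F hℓ hLip κ A' y z v).trans
      (mul_le_mul_of_nonneg_right (mul_le_mul_of_nonneg_left (hA' y z (nbrs_comm.1 hy)) hℓ) (siteNorm_nonneg _))
  unfold l1N
  refine (sum_le_sum fun z _ => hsite z).trans ?_
  rw [sum_add_distrib, ← mul_sum, ← mul_sum]
  refine add_le_add ?_ le_rfl
  refine (mul_le_mul_of_nonneg_left (sum_dirs_le _) (by positivity)).trans (le_of_eq ?_)
  unfold l1N
  field_simp

/-- **THE QUADRATIC TERM SITEWISE WITH THE LOCAL FIELD**: `|(F₁^*F₁u)(z)| ≤ (d+1)ℓ²θ²|u(z)|`.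
[cite: Balaban1983RegularityDecay, p. 581 (2.32)] -/
theorem quad_site_pt (F : OrthFlow ι) {ℓ : ℝ} (hℓ : 0 ≤ ℓ)
    (hLip : ∀ t (v : ι → ℝ), ((F.U t - 1) *ᵥ v) ⬝ᵥ ((F.U t - 1) *ᵥ v) ≤ (ℓ * t) ^ 2 * (v ⬝ᵥ v))
    (κ : ℝ) {n : ℕ} (hn : 1 ≤ n) (N : Fin (d + 1) → ℕ) {A' : ↥(boxDom N) → ↥(boxDom N) → ℝ} {θ : ℝ}
    (hθ : 0 ≤ θ) (hA' : ∀ x y, y.1 ∈ nbrs x.1 → |κ * A' x y| ≤ θ / n) (u : ↥(boxDom N) × ι → ℝ)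
    (z : ↥(boxDom N)) :
    siteNorm (fld (quadOp (boxWt n N) (pertE (fieldLink F κ A')) *ᵥ u) z)
      ≤ ((d : ℝ) + 1) * ℓ ^ 2 * θ ^ 2 * siteNorm (fld u z) := by
  have hn0 : (0 : ℝ) < n := by exact_mod_cast hn
  rw [fld_quadOp_mulVec]
  refine (siteNorm_sum_le _ _).trans ?_
  have hterm : ∀ y, siteNorm (boxWt n N z y • ((pertE (fieldLink F κ A') z y)ᵀ
      *ᵥ (pertE (fieldLink F κ A') z y *ᵥ fld u z))) ≤ boxWt n N z y * ((ℓ * (θ / n)) ^ 2 * siteNorm (fld u z)) := by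
    intro y
    rw [siteNorm_smul, abs_of_nonneg (boxWt_nonneg n N z y)]
    by_cases hy : y.1 ∈ nbrs z.1
    · refine mul_le_mul_of_nonneg_left ?_ (boxWt_nonneg n N z y)
      have h2 : ℓ * |κ * A' z y| ≤ ℓ * (θ / n) := mul_le_mul_of_nonneg_left (hA' z y hy) hℓ
      have h3 : 0 ≤ ℓ * (θ / n) := mul_nonneg hℓ (div_nonneg hθ hn0.le)
      calc siteNorm ((pertE (fieldLink F κ A') z y)ᵀ *ᵥ (pertE (fieldLink F κ A') z y *ᵥ fld u z))
          ≤ ℓ * |κ * A' z y| * siteNorm (pertE (fieldLink F κ A') z y *ᵥ fld u z) :=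
            pertE_transpose_mulVec_le F hℓ hLip κ A' z y _
        _ ≤ ℓ * (θ / n) * (ℓ * (θ / n) * siteNorm (fld u z)) := by
            refine mul_le_mul h2 ?_ (siteNorm_nonneg _) h3
            exact (pertE_mulVec_le F hℓ hLip κ A' z y _).trans
              (mul_le_mul_of_nonneg_right h2 (siteNorm_nonneg _))
        _ = (ℓ * (θ / n)) ^ 2 * siteNorm (fld u z) := by ring
    · simp [boxWt, hy]
  refine (sum_le_sum fun y _ => hterm y).trans ?_
  rw [← sum_mul, sum_boxWt_right]
  have h0 : 0 ≤ (ℓ * (θ / n)) ^ 2 * siteNorm (fld u z) := mul_nonneg (sq_nonneg _) (siteNorm_nonneg _)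
  calc (n : ℝ) ^ 2 / 2 * (((nbrs z.1).filter fun w => w ∈ boxDom N).card : ℝ)
        * ((ℓ * (θ / n)) ^ 2 * siteNorm (fld u z))
      ≤ (n : ℝ) ^ 2 / 2 * (2 * ((d : ℝ) + 1)) * ((ℓ * (θ / n)) ^ 2 * siteNorm (fld u z)) :=
        mul_le_mul_of_nonneg_right (mul_le_mul_of_nonneg_left (card_nbrs_filter_le N z) (by positivity)) h0
    _ = ((d : ℝ) + 1) * ℓ ^ 2 * θ ^ 2 * siteNorm (fld u z) := by field_simp

/-- **`‖F₁^*F₁u‖₁ ≤ (d+1)ℓ²θ²‖u‖₁`**. [cite: Balaban1983RegularityDecay, p. 581 (2.32)] -/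
theorem quad_l1 (F : OrthFlow ι) {ℓ : ℝ} (hℓ : 0 ≤ ℓ)
    (hLip : ∀ t (v : ι → ℝ), ((F.U t - 1) *ᵥ v) ⬝ᵥ ((F.U t - 1) *ᵥ v) ≤ (ℓ * t) ^ 2 * (v ⬝ᵥ v))
    (κ : ℝ) {n : ℕ} (hn : 1 ≤ n) (N : Fin (d + 1) → ℕ) {A' : ↥(boxDom N) → ↥(boxDom N) → ℝ} {θ : ℝ}
    (hθ : 0 ≤ θ) (hA' : ∀ x y, y.1 ∈ nbrs x.1 → |κ * A' x y| ≤ θ / n) (u : ↥(boxDom N) × ι → ℝ) :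
    l1N (quadOp (boxWt n N) (pertE (fieldLink F κ A')) *ᵥ u) ≤ ((d : ℝ) + 1) * ℓ ^ 2 * θ ^ 2 * l1N u := by
  unfold l1N
  rw [mul_sum]
  exact sum_le_sum fun z _ => quad_site_pt F hℓ hLip κ hn N hθ hA' u z

end Box

/-! ## §2b The `a`-terms in `‖·‖₁`: column sums of the block weights for `Q₀, F₂`, row sums for their transposes -/

section ATerms

variable {d : ℕ} (F : OrthFlow ι) {ℓ : ℝ} (κ : ℝ) {n : ℕ} (M : Fin (d + 1) → ℕ)
  (emb : ↥(boxDom M) → ↥(boxDom fun i => n * M i))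
  (Γ : ↥(boxDom M) → ↥(boxDom fun i => n * M i) → List ↥(boxDom fun i => n * M i))
  (A₀ A' : ↥(boxDom fun i => n * M i) → ↥(boxDom fun i => n * M i) → ℝ) {τ : ℝ}

/-- **`‖Q_k(A₀)u‖₁ ≤ ‖u‖₁`** (each fine point lies in one block; transporters orthogonal).
[cite: Balaban1983RegularityDecay, p. 572 (1.4)] -/
theorem avg_l1 (u : ↥(boxDom fun i => n * M i) × ι → ℝ) :
    l1N (avgOp (blkWt n M fun i => n * M i) (contourTrans (fieldLink F κ A₀) emb Γ) *ᵥ u) ≤ l1N u := by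
  refine (l1N_le_of_site (avgOp (blkWt n M fun i => n * M i) (contourTrans (fieldLink F κ A₀) emb Γ) *ᵥ u) u
    (fun y x => blkWt n M (fun i => n * M i) y x) (fun y => ?_)
    (fun x => sum_blkWt_col n M (fun i => n * M i) x)).trans (le_of_eq (one_mul _))
  rw [fld_avgOp_mulVec]
  refine (siteNorm_sum_le _ _).trans (sum_le_sum fun x _ => le_of_eq ?_)
  rw [siteNorm_smul, abs_of_nonneg (blkWt_nonneg n M _ y x), contourTrans_fieldLink, siteNorm_flow]

/-- **`‖F₂u‖₁ ≤ ℓτ‖u‖₁`** under `|κA'(Γ_{y,x})| ≤ τ` on the contours of the blocks («F'_{1,k}(A) = U(A) − 1»,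
`|U(κA'(Γ)) − 1| ≤ ℓ|κA'(Γ)|`). [cite: Balaban1983RegularityDecay, p. 580] -/
theorem pertF_l1 (hℓ : 0 ≤ ℓ)
    (hLip : ∀ t (v : ι → ℝ), ((F.U t - 1) *ᵥ v) ⬝ᵥ ((F.U t - 1) *ᵥ v) ≤ (ℓ * t) ^ 2 * (v ⬝ᵥ v))
    (hτ0 : 0 ≤ τ) (hτ : ∀ y x, blkWt n M (fun i => n * M i) y x ≠ 0 → |κ * lsum A' (emb y) (Γ y x)| ≤ τ)
    (u : ↥(boxDom fun i => n * M i) × ι → ℝ) :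
    l1N (pertF (blkWt n M fun i => n * M i) (contourTrans (fieldLink F κ A') emb Γ)
        (contourTrans (fieldLink F κ A₀) emb Γ) *ᵥ u) ≤ ℓ * τ * l1N u := by
  refine l1N_le_of_site _ u (fun y x => blkWt n M (fun i => n * M i) y x * (ℓ * τ)) (fun y => ?_) (fun x => ?_)
  · rw [pertF, fld_avgOp_mulVec]
    refine (siteNorm_sum_le _ _).trans (sum_le_sum fun x _ => ?_)
    rw [siteNorm_smul, abs_of_nonneg (blkWt_nonneg n M _ y x), mul_assoc]
    by_cases hq : blkWt n M (fun i => n * M i) y x = 0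
    · rw [hq, zero_mul, zero_mul]
    refine mul_le_mul_of_nonneg_left ?_ (blkWt_nonneg n M _ y x)
    rw [kmul_apply, pertT, ← mulVec_mulVec, contourTrans_fieldLink, contourTrans_fieldLink]
    refine (siteNorm_flow_sub_one_le F hℓ hLip _ _).trans ?_
    rw [siteNorm_flow]
    exact mul_le_mul_of_nonneg_right (mul_le_mul_of_nonneg_left (hτ y x hq) hℓ) (siteNorm_nonneg _)
  · rw [← sum_mul]
    have h1 := sum_blkWt_col n M (fun i => n * M i) x
    have h2 : 0 ≤ ℓ * τ := mul_nonneg hℓ hτ0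
    nlinarith

/-- **`‖Q_k(A₀)ᵀw‖₁ ≤ n^{d+1}‖w‖₁`** (a unit block holds `n^{d+1}` fine points).
[cite: Balaban1983RegularityDecay, p. 572 (1.5)] -/
theorem avgT_l1 (hn : 1 ≤ n) (w : ↥(boxDom M) × ι → ℝ) :
    l1N ((avgOp (blkWt n M fun i => n * M i) (contourTrans (fieldLink F κ A₀) emb Γ))ᵀ *ᵥ w)
      ≤ (n : ℝ) ^ (d + 1) * l1N w := by
  refine l1N_le_of_site _ w (fun x y => blkWt n M (fun i => n * M i) y x) (fun x => ?_)
    (fun y => sum_blkWt_row hn M y)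
  rw [fld_avgOp_transpose_mulVec]
  refine (siteNorm_sum_le _ _).trans (sum_le_sum fun y _ => ?_)
  rw [siteNorm_smul, abs_of_nonneg (blkWt_nonneg n M _ y x), contourTrans_fieldLink, F.transpose_eq, siteNorm_flow]

/-- **`‖F₂ᵀw‖₁ ≤ n^{d+1}ℓτ‖w‖₁`**. [cite: Balaban1983RegularityDecay, p. 580] -/
theorem pertFT_l1 (hℓ : 0 ≤ ℓ)
    (hLip : ∀ t (v : ι → ℝ), ((F.U t - 1) *ᵥ v) ⬝ᵥ ((F.U t - 1) *ᵥ v) ≤ (ℓ * t) ^ 2 * (v ⬝ᵥ v))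
    (hn : 1 ≤ n) (hτ0 : 0 ≤ τ)
    (hτ : ∀ y x, blkWt n M (fun i => n * M i) y x ≠ 0 → |κ * lsum A' (emb y) (Γ y x)| ≤ τ)
    (w : ↥(boxDom M) × ι → ℝ) :
    l1N ((pertF (blkWt n M fun i => n * M i) (contourTrans (fieldLink F κ A') emb Γ)
        (contourTrans (fieldLink F κ A₀) emb Γ))ᵀ *ᵥ w) ≤ (n : ℝ) ^ (d + 1) * (ℓ * τ) * l1N w := by
  refine l1N_le_of_site _ w (fun x y => blkWt n M (fun i => n * M i) y x * (ℓ * τ)) (fun x => ?_) (fun y => ?_)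
  · rw [pertF, fld_avgOp_transpose_mulVec]
    refine (siteNorm_sum_le _ _).trans (sum_le_sum fun y _ => ?_)
    rw [siteNorm_smul, abs_of_nonneg (blkWt_nonneg n M _ y x), mul_assoc]
    by_cases hq : blkWt n M (fun i => n * M i) y x = 0
    · rw [hq, zero_mul, zero_mul]
    refine mul_le_mul_of_nonneg_left ?_ (blkWt_nonneg n M _ y x)
    rw [kmul_apply, pertT, Matrix.transpose_mul, ← mulVec_mulVec, contourTrans_fieldLink, contourTrans_fieldLink,
      F.transpose_eq, siteNorm_flow, Matrix.transpose_sub, Matrix.transpose_one, F.transpose_eq]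
    refine (siteNorm_flow_sub_one_le F hℓ hLip _ _).trans ?_
    rw [abs_neg]
    exact mul_le_mul_of_nonneg_right (mul_le_mul_of_nonneg_left (hτ y x hq) hℓ) (siteNorm_nonneg _)
  · rw [← sum_mul]
    exact mul_le_mul_of_nonneg_right (sum_blkWt_row hn M y) (mul_nonneg hℓ hτ0)

/-- **THE `a`-TERMS ARE ZEROTH-ORDER SMALL IN `‖·‖₁`**: `‖a(F₂^*Q₀ + Q₀^*F₂ + F₂^*F₂)u‖₁ ≤
|a|·n^{d+1}·ℓτ(2+ℓτ)·‖u‖₁`. [cite: Balaban1983RegularityDecay, p. 581 (2.32); p. 579 (2.24)] -/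
theorem aterm_l1N_le (hℓ : 0 ≤ ℓ)
    (hLip : ∀ t (v : ι → ℝ), ((F.U t - 1) *ᵥ v) ⬝ᵥ ((F.U t - 1) *ᵥ v) ≤ (ℓ * t) ^ 2 * (v ⬝ᵥ v))
    (hn : 1 ≤ n) (hτ0 : 0 ≤ τ)
    (hτ : ∀ y x, blkWt n M (fun i => n * M i) y x ≠ 0 → |κ * lsum A' (emb y) (Γ y x)| ≤ τ) (a : ℝ)
    (u : ↥(boxDom fun i => n * M i) × ι → ℝ) :
    l1N ((a • ((pertF (blkWt n M fun i => n * M i) (contourTrans (fieldLink F κ A') emb Γ)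
          (contourTrans (fieldLink F κ A₀) emb Γ))ᵀ
        * avgOp (blkWt n M fun i => n * M i) (contourTrans (fieldLink F κ A₀) emb Γ)
      + (avgOp (blkWt n M fun i => n * M i) (contourTrans (fieldLink F κ A₀) emb Γ))ᵀ
        * pertF (blkWt n M fun i => n * M i) (contourTrans (fieldLink F κ A') emb Γ)
          (contourTrans (fieldLink F κ A₀) emb Γ)
      + (pertF (blkWt n M fun i => n * M i) (contourTrans (fieldLink F κ A') emb Γ)
          (contourTrans (fieldLink F κ A₀) emb Γ))ᵀ
        * pertF (blkWt n M fun i => n * M i) (contourTrans (fieldLink F κ A') emb Γ)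
          (contourTrans (fieldLink F κ A₀) emb Γ))) *ᵥ u)
      ≤ |a| * ((n : ℝ) ^ (d + 1) * (ℓ * τ * (2 + ℓ * τ))) * l1N u := by
  set Q := avgOp (blkWt n M fun i => n * M i) (contourTrans (fieldLink F κ A₀) emb Γ) with hQ
  set P := pertF (blkWt n M fun i => n * M i) (contourTrans (fieldLink F κ A') emb Γ)
    (contourTrans (fieldLink F κ A₀) emb Γ) with hP
  have hu := l1N_nonneg u
  have hℓτ : 0 ≤ ℓ * τ := mul_nonneg hℓ hτ0
  have hnp : 0 ≤ (n : ℝ) ^ (d + 1) := by positivity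
  have h1 : l1N ((Pᵀ * Q) *ᵥ u) ≤ (n : ℝ) ^ (d + 1) * (ℓ * τ) * l1N u := by
    rw [← mulVec_mulVec]
    refine (pertFT_l1 F κ M emb Γ A₀ A' hℓ hLip hn hτ0 hτ _).trans ?_
    exact mul_le_mul_of_nonneg_left (avg_l1 F κ M emb Γ A₀ u) (mul_nonneg hnp hℓτ)
  have h2 : l1N ((Qᵀ * P) *ᵥ u) ≤ (n : ℝ) ^ (d + 1) * (ℓ * τ * l1N u) := by
    rw [← mulVec_mulVec]
    refine (avgT_l1 F κ M emb Γ A₀ hn _).trans ?_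
    exact mul_le_mul_of_nonneg_left (pertF_l1 F κ M emb Γ A₀ A' hℓ hLip hτ0 hτ u) hnp
  have h3 : l1N ((Pᵀ * P) *ᵥ u) ≤ (n : ℝ) ^ (d + 1) * (ℓ * τ) * (ℓ * τ * l1N u) := by
    rw [← mulVec_mulVec]
    refine (pertFT_l1 F κ M emb Γ A₀ A' hℓ hLip hn hτ0 hτ _).trans ?_
    exact mul_le_mul_of_nonneg_left (pertF_l1 F κ M emb Γ A₀ A' hℓ hLip hτ0 hτ u) (mul_nonneg hnp hℓτ)
  rw [smul_mulVec, l1N_smul, mul_assoc]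
  refine mul_le_mul_of_nonneg_left ?_ (abs_nonneg a)
  rw [add_mulVec, add_mulVec]
  refine ((l1N_add_le _ _).trans (add_le_add ((l1N_add_le _ _).trans (add_le_add h1 h2)) h3)).trans ?_
  have : (n : ℝ) ^ (d + 1) * (ℓ * τ) * l1N u + (n : ℝ) ^ (d + 1) * (ℓ * τ * l1N u)
      + (n : ℝ) ^ (d + 1) * (ℓ * τ) * (ℓ * τ * l1N u) = (n : ℝ) ^ (d + 1) * (ℓ * τ * (2 + ℓ * τ)) * l1N u := by
    ring
  rw [this]

/-- the same with [B4]'s coefficient `a = a_k·n^{-(d+1)}`, `a_k ≥ 0`: `≤ a_kℓτ(2+ℓτ)‖u‖₁`.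
[cite: Balaban1983RegularityDecay, p. 581 (2.32)] -/
theorem aterm_l1N_le' (hℓ : 0 ≤ ℓ)
    (hLip : ∀ t (v : ι → ℝ), ((F.U t - 1) *ᵥ v) ⬝ᵥ ((F.U t - 1) *ᵥ v) ≤ (ℓ * t) ^ 2 * (v ⬝ᵥ v))
    (hn : 1 ≤ n) (hτ0 : 0 ≤ τ)
    (hτ : ∀ y x, blkWt n M (fun i => n * M i) y x ≠ 0 → |κ * lsum A' (emb y) (Γ y x)| ≤ τ) {ak : ℝ}
    (hak : 0 ≤ ak) (u : ↥(boxDom fun i => n * M i) × ι → ℝ) :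
    l1N (((ak * ((n : ℝ) ^ (d + 1))⁻¹) • ((pertF (blkWt n M fun i => n * M i)
          (contourTrans (fieldLink F κ A') emb Γ) (contourTrans (fieldLink F κ A₀) emb Γ))ᵀ
        * avgOp (blkWt n M fun i => n * M i) (contourTrans (fieldLink F κ A₀) emb Γ)
      + (avgOp (blkWt n M fun i => n * M i) (contourTrans (fieldLink F κ A₀) emb Γ))ᵀ
        * pertF (blkWt n M fun i => n * M i) (contourTrans (fieldLink F κ A') emb Γ)
          (contourTrans (fieldLink F κ A₀) emb Γ)
      + (pertF (blkWt n M fun i => n * M i) (contourTrans (fieldLink F κ A') emb Γ)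
          (contourTrans (fieldLink F κ A₀) emb Γ))ᵀ
        * pertF (blkWt n M fun i => n * M i) (contourTrans (fieldLink F κ A') emb Γ)
          (contourTrans (fieldLink F κ A₀) emb Γ))) *ᵥ u)
      ≤ ak * (ℓ * τ * (2 + ℓ * τ)) * l1N u := by
  have hn0 : (0 : ℝ) < (n : ℝ) ^ (d + 1) := by positivity
  refine (aterm_l1N_le F κ M emb Γ A₀ A' hℓ hLip hn hτ0 hτ _ u).trans (le_of_eq ?_)
  rw [abs_of_nonneg (by positivity), mul_assoc ak, ← mul_assoc (((n : ℝ) ^ (d + 1))⁻¹), inv_mul_cancel₀ hn0.ne',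
    one_mul]

end ATerms

/-! ## §3 `V_k` IS FIRST-ORDER SMALL IN `‖·‖₁` RELATIVE TO `(D^η_{A₀,μ})_μ` -/

section Assembly

variable {d : ℕ}

/-- **`−V = vOp = C + Cᵀ + F₁^*F₁ + a(F₂^*Q₀ + Q₀^*F₂ + F₂^*F₂)` IS FIRST-ORDER SMALL IN `‖·‖₁` RELATIVE TO
`(D^η_{A₀,μ})_μ`** on the fine box `Π[0,nM_μ)` with [B4]'s weights, for an antisymmetric background `A₀` and a
perturbation `A'` with `|κA'_b| ≤ θ/n` (nearest-neighbour bonds), `|κ(A'(b') − A'(b))| ≤ θ'/n²` (consecutive parallel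
bonds), `A' = 0` on the `μ`-bonds touching the `μ`-faces, `|κA'(Γ_{y,x})| ≤ τ` (block contours): constant
`(ℓθ + (d+1)ℓθ') + ℓθ + (d+1)ℓ²θ² + a_kℓτ(2+ℓτ)`. [cite: Balaban1983RegularityDecay, p. 581 (2.32)] -/
theorem firstOrderSmall_vOp_l1 (F : OrthFlow ι) {ℓ : ℝ} (hℓ : 0 ≤ ℓ)
    (hLip : ∀ t (v : ι → ℝ), ((F.U t - 1) *ᵥ v) ⬝ᵥ ((F.U t - 1) *ᵥ v) ≤ (ℓ * t) ^ 2 * (v ⬝ᵥ v))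
    (κ : ℝ) {n : ℕ} (hn : 1 ≤ n) (M : Fin (d + 1) → ℕ) (emb : ↥(boxDom M) → ↥(boxDom fun i => n * M i))
    (Γ : ↥(boxDom M) → ↥(boxDom fun i => n * M i) → List ↥(boxDom fun i => n * M i))
    (A₀ : ↥(boxDom fun i => n * M i) → ↥(boxDom fun i => n * M i) → ℝ) (hanti : ∀ x y, A₀ y x = -A₀ x y)
    {A' : ↥(boxDom fun i => n * M i) → ↥(boxDom fun i => n * M i) → ℝ} {θ θ' τ ak : ℝ} (hθ : 0 ≤ θ)
    (hA' : ∀ x y, y.1 ∈ nbrs x.1 → |κ * A' x y| ≤ θ / n) (hθ' : 0 ≤ θ')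
    (hder : ∀ (x z y : ↥(boxDom fun i => n * M i)) (μ : Fin (d + 1)), z.1 = x.1 + e1 μ → y.1 = z.1 + e1 μ →
      |κ * (A' y z - A' z x)| ≤ θ' / (n : ℝ) ^ 2 ∧ |κ * (A' x z - A' z y)| ≤ θ' / (n : ℝ) ^ 2)
    (hbd : ∀ (x y : ↥(boxDom fun i => n * M i)) (μ : Fin (d + 1)), y.1 = x.1 + e1 μ →
      (x.1 - e1 μ ∉ boxDom (fun i => n * M i) ∨ y.1 + e1 μ ∉ boxDom (fun i => n * M i)) →
      A' x y = 0 ∧ A' y x = 0)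
    (hτ0 : 0 ≤ τ) (hτ : ∀ y x, blkWt n M (fun i => n * M i) y x ≠ 0 → |κ * lsum A' (emb y) (Γ y x)| ≤ τ)
    (hak : 0 ≤ ak) :
    FirstOrderSmall l1N
      (-vOp (boxWt n fun i => n * M i) (ak * ((n : ℝ) ^ (d + 1))⁻¹) (blkWt n M fun i => n * M i)
        (fieldLink F κ A') (fieldLink F κ A₀) (contourTrans (fieldLink F κ A') emb Γ)
        (contourTrans (fieldLink F κ A₀) emb Γ))
      (covDeriv n (boxDom fun i => n * M i) (fieldLink F κ A₀))
      (ℓ * θ + ((d : ℝ) + 1) * ℓ * θ' + ℓ * θ + ((d : ℝ) + 1) * ℓ ^ 2 * θ ^ 2 + ak * (ℓ * τ * (2 + ℓ * τ))) := by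
  refine firstOrderSmall_neg' l1N_neg ?_
  rw [vOp]
  have hC : FirstOrderSmall l1N
      (crossOp (boxWt n fun i => n * M i) (fieldLink F κ A₀) (pertE (fieldLink F κ A')))
      (covDeriv n (boxDom fun i => n * M i) (fieldLink F κ A₀)) (ℓ * θ + ((d : ℝ) + 1) * ℓ * θ') :=
    firstOrderSmall_of_le' l1N_nonneg (by positivity) (mul_nonneg hℓ hθ) fun u =>
      cross_l1 F hℓ hLip κ hn _ A₀ hanti hθ hA' hθ' hder hbd u
  have hCT : FirstOrderSmall l1N
      (crossOp (boxWt n fun i => n * M i) (fieldLink F κ A₀) (pertE (fieldLink F κ A')))ᵀ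
      (covDeriv n (boxDom fun i => n * M i) (fieldLink F κ A₀)) (ℓ * θ) := by
    have key := firstOrderSmall_of_le' (ε₀ := 0) l1N_nonneg le_rfl (mul_nonneg hℓ hθ) fun u => by
      rw [zero_mul, add_zero]; exact crossT_l1 F hℓ hLip κ hn _ A₀ hanti hθ hA' u
    rwa [add_zero] at key
  have hQ : FirstOrderSmall l1N (quadOp (boxWt n fun i => n * M i) (pertE (fieldLink F κ A')))
      (covDeriv n (boxDom fun i => n * M i) (fieldLink F κ A₀)) (((d : ℝ) + 1) * ℓ ^ 2 * θ ^ 2) :=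
    firstOrderSmall_of_zeroth' l1N_nonneg _ (by positivity) fun u => quad_l1 F hℓ hLip κ hn _ hθ hA' u
  exact firstOrderSmall_add' l1N_add_le (firstOrderSmall_add' l1N_add_le (firstOrderSmall_add' l1N_add_le hC hCT)
    hQ) (firstOrderSmall_of_zeroth' l1N_nonneg _ (by positivity) fun u =>
      aterm_l1N_le' F κ M emb Γ A₀ A' hℓ hLip hn hτ0 hτ hak u)

/-- **[B4]'s `V` OF (2.24)/(2.31) (`B4Lemma22ReduceZero.pertV`) IS FIRST-ORDER SMALL IN `‖·‖₁` RELATIVE TO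
`D^η_{A₀}`** («V_k can be interpreted as a first order differential operator acting on a function on the right hand
side of it», here in the `L¹` norm), with the constant of the sup row
`(d+1)ℓ₁(θ+θ') + (d+1)ℓ₁θ + (d+1)ℓ₁²θ² + a_kℓ₁τ(2+ℓ₁τ)` (which dominates the `ℓ¹` constant of
`firstOrderSmall_vOp_l1`). [cite: Balaban1983RegularityDecay, p. 581 (2.32); pp. 579–580 (2.24)–(2.25)] -/
theorem firstOrderSmall_pertV_l1 (F : OrthFlow ι) {ℓ₁ : ℝ} (hℓ₁ : 0 ≤ ℓ₁)
    (hLip : ∀ t (v : ι → ℝ), ((F.U t - 1) *ᵥ v) ⬝ᵥ ((F.U t - 1) *ᵥ v) ≤ (ℓ₁ * t) ^ 2 * (v ⬝ᵥ v))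
    (κ : ℝ) {ℓ k : ℕ} (hℓ : 1 ≤ ℓ) (hk : 1 ≤ k) {a : ℝ} (ha : 0 < a) (M : Fin (d + 1) → ℕ)
    (emb : ↥(boxDom M) → ↥(Box d ℓ k M)) (Γ : ↥(boxDom M) → ↥(Box d ℓ k M) → List ↥(Box d ℓ k M))
    (A₀ : Fin (d + 1) → ℝ) {A' : ↥(Box d ℓ k M) → ↥(Box d ℓ k M) → ℝ} {θ θ' τ : ℝ} (hθ : 0 ≤ θ)
    (hA' : ∀ x y : ↥(Box d ℓ k M), y.1 ∈ nbrs x.1 → |κ * A' x y| ≤ θ / ((ℓ + 1) ^ k : ℕ)) (hθ' : 0 ≤ θ')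
    (hder : ∀ (x z y : ↥(Box d ℓ k M)) (μ : Fin (d + 1)), z.1 = x.1 + e1 μ → y.1 = z.1 + e1 μ →
      |κ * (A' y z - A' z x)| ≤ θ' / (((ℓ + 1) ^ k : ℕ) : ℝ) ^ 2 ∧
      |κ * (A' x z - A' z y)| ≤ θ' / (((ℓ + 1) ^ k : ℕ) : ℝ) ^ 2)
    (hbd : ∀ (x y : ↥(Box d ℓ k M)) (μ : Fin (d + 1)), y.1 = x.1 + e1 μ →
      (x.1 - e1 μ ∉ Box d ℓ k M ∨ y.1 + e1 μ ∉ Box d ℓ k M) → A' x y = 0 ∧ A' y x = 0)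
    (hτ0 : 0 ≤ τ)
    (hτ : ∀ y x, blkWt ((ℓ + 1) ^ k) M (fun i => (ℓ + 1) ^ k * M i) y x ≠ 0 →
      |κ * lsum A' (emb y) (Γ y x)| ≤ τ) :
    FirstOrderSmall l1N (pertV d F κ ℓ k a M emb Γ A₀ A') (derivA0 d F κ ℓ k M A₀)
      (((d : ℝ) + 1) * ℓ₁ * (θ + θ') + ((d : ℝ) + 1) * ℓ₁ * θ + ((d : ℝ) + 1) * ℓ₁ ^ 2 * θ ^ 2
        + B1.aSeq a ((ℓ : ℝ) + 1) k * (ℓ₁ * τ * (2 + ℓ₁ * τ))) := by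
  have hn : 1 ≤ (ℓ + 1) ^ k := Nat.one_le_pow _ _ (Nat.succ_pos ℓ)
  have hL : (1 : ℝ) < (ℓ : ℝ) + 1 := by
    have : (1 : ℝ) ≤ ℓ := by exact_mod_cast hℓ
    linarith
  have hak : 0 ≤ B1.aSeq a ((ℓ : ℝ) + 1) k := (B1.aSeq_pos ha hL hk).le
  have key := firstOrderSmall_vOp_l1 F hℓ₁ hLip κ hn M emb Γ (constBond A₀ Subtype.val)
    (constBond_antisymm A₀ Subtype.val) hθ hA' hθ' hder hbd hτ0 hτ hak
  refine firstOrderSmall_mono' l1N_nonneg key ?_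
  have hd : 0 ≤ (d : ℝ) * ℓ₁ * θ := by positivity
  have hd' : 0 ≤ (d : ℝ) * ℓ₁ * θ' := by positivity
  nlinarith

/-! ## §4 LEMMA 2.2 (2.17): THE `ℓ¹` ROW, MEMBERS `G`, `D^η_{Ã,μ}G`, AND THE SUP ROW, MEMBER `G D^{η*}_{Ã,μ}`, FOR
`G_k(□,Ã)` ON A BOX -/

/-- **LEMMA 2.2 (2.17) FOR [B4]'s `G_k(□,Ã)`, `Ã = A₀ + A'`, ON A FINE BOX: THE ROW `q = p = 1`, MEMBERS `G` AND
`D^η_μG` (both derivative conventions), AND — BY DUALITY («For q = p = 1 we get it by duality argument, i.e. using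
the fact that the space L^∞(□) is adjoint to L¹(□).», `Gᵀ = G`) — THE ROW `q = p = ∞`, MEMBER `G D^{η*}_μ` (both
conventions)**, under EXACTLY the hypotheses of `B4Lemma22CrossSup.lemma22_17_sup_box`: there is `c > 0` (uniform
on the window `a ∈ [amin, aplus]`, `m² ∈ [0, m2plus]`, all `k ≥ 1`, all boxes, all contour systems ending at the
averaged point, all constant `A₀`) such that IF `H_k(□,Ã)` is invertible, `|κA'_b| ≤ θ/n` on nearest-neighbour bonds,
`|κ(A'(b') − A'(b))| ≤ θ'/n²` on consecutive parallel bonds, `A' = 0` on the `μ`-bonds touching the `μ`-faces,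
`|κA'(Γ_{y,x})| ≤ τ` along the block contours and
`(d+2)c((d+1)ℓ(θ+θ') + (d+1)ℓθ + (d+1)ℓ²θ² + a_kℓτ(2+ℓτ)) ≤ 1/2` («for e sufficiently small»), THEN for every `f`:
`‖Gf‖₁ + Σ_μ‖D^η_{A₀,μ}Gf‖₁ ≤ 2(d+2)c‖f‖₁`, `‖D^η_{Ã,μ}Gf‖₁ ≤ (1+ℓθ)·2(d+2)c‖f‖₁`,
`‖G(D^η_{A₀,μ})ᵀf‖_∞ ≤ 2(d+2)c‖f‖_∞`, `‖G(D^η_{Ã,μ})ᵀf‖_∞ ≤ (1+ℓθ)·2(d+2)c‖f‖_∞` (`(D^η_μ)ᵀ = D^{η*}_μ`, the real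
adjoint), `G = G_k(□,Ã)`.
[cite: Balaban1983RegularityDecay, Lemma 2.2 (2.17) p. 578; proof pp. 579–583 (2.23)–(2.25), (2.31)–(2.33)] -/
theorem lemma22_17_l1_box (F : OrthFlow ι) {ℓ₁ : ℝ} (hℓ₁ : 0 ≤ ℓ₁)
    (hLip : ∀ t (v : ι → ℝ), ((F.U t - 1) *ᵥ v) ⬝ᵥ ((F.U t - 1) *ᵥ v) ≤ (ℓ₁ * t) ^ 2 * (v ⬝ᵥ v))
    (κ : ℝ) (d ℓ : ℕ) (hℓ : 1 ≤ ℓ) (amin aplus m2plus : ℝ) (ha : 0 < amin) :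
    ∃ c : ℝ, 0 < c ∧ ∀ (k : ℕ), 1 ≤ k → ∀ (a m2 : ℝ), amin ≤ a → a ≤ aplus → 0 ≤ m2 → m2 ≤ m2plus →
      ∀ (M : Fin (d + 1) → ℕ), (∀ i, 1 ≤ M i) →
      ∀ (emb : ↥(boxDom M) → ↥(Box d ℓ k M)) (Γ : ↥(boxDom M) → ↥(Box d ℓ k M) → List ↥(Box d ℓ k M)),
        (∀ y x, blkWt ((ℓ + 1) ^ k) M (fun i => (ℓ + 1) ^ k * M i) y x ≠ 0 → pathEnd (emb y) (Γ y x) = x) →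
      ∀ (A₀ : Fin (d + 1) → ℝ) (A' : ↥(Box d ℓ k M) → ↥(Box d ℓ k M) → ℝ) (θ θ' τ : ℝ),
        IsUnit (opA d F κ ℓ k a m2 M emb Γ (constBond A₀ Subtype.val + A')).det →
        0 ≤ θ → (∀ x y : ↥(Box d ℓ k M), y.1 ∈ nbrs x.1 → |κ * A' x y| ≤ θ / ((ℓ + 1) ^ k : ℕ)) →
        0 ≤ θ' → (∀ (x z y : ↥(Box d ℓ k M)) (μ : Fin (d + 1)), z.1 = x.1 + e1 μ → y.1 = z.1 + e1 μ →
          |κ * (A' y z - A' z x)| ≤ θ' / (((ℓ + 1) ^ k : ℕ) : ℝ) ^ 2 ∧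
          |κ * (A' x z - A' z y)| ≤ θ' / (((ℓ + 1) ^ k : ℕ) : ℝ) ^ 2) →
        (∀ (x y : ↥(Box d ℓ k M)) (μ : Fin (d + 1)), y.1 = x.1 + e1 μ →
          (x.1 - e1 μ ∉ Box d ℓ k M ∨ y.1 + e1 μ ∉ Box d ℓ k M) → A' x y = 0 ∧ A' y x = 0) →
        0 ≤ τ → (∀ y x, blkWt ((ℓ + 1) ^ k) M (fun i => (ℓ + 1) ^ k * M i) y x ≠ 0 →
          |κ * lsum A' (emb y) (Γ y x)| ≤ τ) →
        ((d : ℝ) + 2) * c * (((d : ℝ) + 1) * ℓ₁ * (θ + θ') + ((d : ℝ) + 1) * ℓ₁ * θ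
          + ((d : ℝ) + 1) * ℓ₁ ^ 2 * θ ^ 2 + B1.aSeq a ((ℓ : ℝ) + 1) k * (ℓ₁ * τ * (2 + ℓ₁ * τ))) ≤ 1 / 2 →
        ∀ f : ↥(Box d ℓ k M) × ι → ℝ,
          l1N (greenA d F κ ℓ k a m2 M emb Γ (constBond A₀ Subtype.val + A') *ᵥ f)
              + ∑ μ, l1N (derivA0 d F κ ℓ k M A₀ μ
                  *ᵥ (greenA d F κ ℓ k a m2 M emb Γ (constBond A₀ Subtype.val + A') *ᵥ f))
              ≤ 2 * (((d : ℝ) + 2) * c) * l1N f ∧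
          (∀ μ : Fin (d + 1),
            l1N (derivA d F κ ℓ k M (constBond A₀ Subtype.val + A') μ
                *ᵥ (greenA d F κ ℓ k a m2 M emb Γ (constBond A₀ Subtype.val + A') *ᵥ f))
              ≤ (1 + ℓ₁ * θ) * (2 * (((d : ℝ) + 2) * c)) * l1N f) ∧
          (∀ μ : Fin (d + 1),
            supN ((greenA d F κ ℓ k a m2 M emb Γ (constBond A₀ Subtype.val + A')
                * (derivA0 d F κ ℓ k M A₀ μ)ᵀ) *ᵥ f) ≤ 2 * (((d : ℝ) + 2) * c) * supN f) ∧
          ∀ μ : Fin (d + 1),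
            supN ((greenA d F κ ℓ k a m2 M emb Γ (constBond A₀ Subtype.val + A')
                * (derivA d F κ ℓ k M (constBond A₀ Subtype.val + A') μ)ᵀ) *ᵥ f)
              ≤ (1 + ℓ₁ * θ) * (2 * (((d : ℝ) + 2) * c)) * supN f := by
  obtain ⟨c, hc, h⟩ := const_box_l1 F κ d ℓ hℓ amin aplus m2plus ha
  refine ⟨c, hc, ?_⟩
  intro k hk a m2 e1' e2 e3 e4 M hM emb Γ hend A₀ A' θ θ' τ hunit hθ hA' hθ' hder hbd hτ0 hτ hsm f
  obtain ⟨h0, hD⟩ := h k hk a m2 e1' e2 e3 e4 M hM emb Γ hend A₀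
  have hn : 1 ≤ (ℓ + 1) ^ k := Nat.one_le_pow _ _ (Nat.succ_pos ℓ)
  have hres := greenA_resolvent F κ hℓ hk (lt_of_lt_of_le ha e1') e3 hM hend A₀ hunit
  have hV := firstOrderSmall_pertV_l1 F hℓ₁ hLip κ hℓ hk (lt_of_lt_of_le ha e1') M emb Γ A₀ hθ hA' hθ' hder hbd
    hτ0 hτ
  have hsm' : ((Fintype.card (Fin (d + 1)) : ℝ) + 1) * c * (((d : ℝ) + 1) * ℓ₁ * (θ + θ')
      + ((d : ℝ) + 1) * ℓ₁ * θ + ((d : ℝ) + 1) * ℓ₁ ^ 2 * θ ^ 2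
      + B1.aSeq a ((ℓ : ℝ) + 1) k * (ℓ₁ * τ * (2 + ℓ₁ * τ))) ≤ 1 / 2 := by
    rw [card_dir_add_one]; exact hsm
  have hD' : ∀ (μ : Fin (d + 1)) (u : ↥(Box d ℓ k M) × ι → ℝ),
      l1N ((derivA d F κ ℓ k M (constBond A₀ Subtype.val + A') μ - derivA0 d F κ ℓ k M A₀ μ) *ᵥ u)
        ≤ ℓ₁ * θ * (l1N u + ∑ ν', l1N (derivA0 d F κ ℓ k M A₀ ν' *ᵥ u)) := by
    intro μ u
    refine (covDeriv_sub_l1N_le F hℓ₁ hLip κ hn (constBond A₀ Subtype.val) hθ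
      (fun x y hy => hA' x y (hy ▸ add_e1_mem_nbrs x.1 μ)) u).trans ?_
    exact mul_le_mul_of_nonneg_left (le_add_of_nonneg_right (sum_nonneg fun _ _ => l1N_nonneg _))
      (mul_nonneg hℓ₁ hθ)
  have hGt : (greenA d F κ ℓ k a m2 M emb Γ (constBond A₀ Subtype.val + A'))ᵀ
      = greenA d F κ ℓ k a m2 M emb Γ (constBond A₀ Subtype.val + A') := b4Green_transpose F κ _ _ _ _ _ _ _
  refine ⟨?_, fun μ => ?_, fun μ => ?_, fun μ => ?_⟩
  · have key := reduce_l1 (κ := Fin (d + 1)) hres hc.le h0 hD hV hsm' f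
    rw [card_dir_add_one] at key
    exact key
  · have key := deriv_convert (κ := Fin (d + 1)) l1N_nonneg l1N_add_le hres hc.le h0 hD hV hsm'
      (mul_nonneg hℓ₁ hθ) hD' μ f
    rw [card_dir_add_one] at key
    exact key
  · have key := bootstrap_dual (κ := Fin (d + 1)) hres hGt hc.le h0 hD hV hsm' μ f
    rw [card_dir_add_one] at key
    exact key
  · have hT : greenA d F κ ℓ k a m2 M emb Γ (constBond A₀ Subtype.val + A')
        * (derivA d F κ ℓ k M (constBond A₀ Subtype.val + A') μ)ᵀ
        = (derivA d F κ ℓ k M (constBond A₀ Subtype.val + A') μ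
            * greenA d F κ ℓ k a m2 M emb Γ (constBond A₀ Subtype.val + A'))ᵀ := by
      rw [Matrix.transpose_mul, hGt]
    rw [hT]
    have hC1 : 0 ≤ (1 + ℓ₁ * θ) * (2 * (((d : ℝ) + 2) * c)) := by
      have := mul_nonneg hℓ₁ hθ
      positivity
    refine supN_transpose_le hC1 (fun Φ => ?_) f
    rw [← Matrix.mulVec_mulVec]
    have key := deriv_convert (κ := Fin (d + 1)) l1N_nonneg l1N_add_le hres hc.le h0 hD hV hsm'
      (mul_nonneg hℓ₁ hθ) hD' μ Φ
    rw [card_dir_add_one] at key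
    exact key

/-! ## §5 THE STAIRCASE SPECIALISATION: INVERTIBILITY AND CONTOUR HYPOTHESES DISCHARGED -/

/-- **LEMMA 2.2 (2.17), `q = p = 1`, MEMBERS `G`, `D^η_{Ã,μ}G` (AND `q = p = ∞`, MEMBER `G D^{η*}_{Ã,μ}`), FOR
[B4]'s `G_k(□,Ã)` ON A FINE BOX WITH THE STAIRCASE CONTOURS — ALL OPERATOR-SIDE HYPOTHESES DISCHARGED** (as in
`B4Lemma22SupStair.lemma22_17_sup_stair`: invertibility from `B4Lower18Regular.green_box_l2_bound` under
`ℓ²θ²(d+1)(1 + a_k(d+1)) ≤ min(2,a_k)/4`, contour ends from `stairContour_end`, `τ = (d+1)θ` from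
`B4Lemma22SupStair.stair_lsum_le`): under the same hypotheses as `B4Lemma22DualL1.lemma22_17_l1_stair`, for every
`f`: `‖Gf‖₁ + Σ_μ‖D^η_{A₀,μ}Gf‖₁ ≤ 2(d+2)c‖f‖₁`, `‖D^η_{Ã,μ}Gf‖₁ ≤ (1+ℓ₁θ)·2(d+2)c‖f‖₁`,
`‖G(D^η_{A₀,μ})ᵀf‖_∞ ≤ 2(d+2)c‖f‖_∞`, `‖G(D^η_{Ã,μ})ᵀf‖_∞ ≤ (1+ℓ₁θ)·2(d+2)c‖f‖_∞`.  Together with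
`B4Lemma22SupStair.lemma22_17_sup_stair` and `B4Lemma22DualL1.lemma22_17_l1_stair`: all three members `n ≤ 1` of
(2.17) in both rows `q = p = ∞` and `q = p = 1`.
[cite: Balaban1983RegularityDecay, Lemma 2.2 (2.17) p. 578; proof pp. 579–583] -/
theorem lemma22_17_l1_deriv_stair (F : OrthFlow ι) {ℓ₁ : ℝ} (hℓ₁ : 0 ≤ ℓ₁)
    (hLip : ∀ t (v : ι → ℝ), ((F.U t - 1) *ᵥ v) ⬝ᵥ ((F.U t - 1) *ᵥ v) ≤ (ℓ₁ * t) ^ 2 * (v ⬝ᵥ v))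
    (κ : ℝ) (d ℓ : ℕ) (hℓ : 1 ≤ ℓ) (amin aplus m2plus : ℝ) (ha : 0 < amin) :
    ∃ c : ℝ, 0 < c ∧ ∀ (k : ℕ), 1 ≤ k → ∀ (hn : 1 ≤ (ℓ + 1) ^ k) (a m2 : ℝ),
      amin ≤ a → a ≤ aplus → 0 ≤ m2 → m2 ≤ m2plus →
      ∀ (M : Fin (d + 1) → ℕ), (∀ i, 1 ≤ M i) →
      ∀ (A₀ : Fin (d + 1) → ℝ) (A' : ↥(Box d ℓ k M) → ↥(Box d ℓ k M) → ℝ) (θ θ' : ℝ),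
        0 ≤ θ → (∀ x y : ↥(Box d ℓ k M), y.1 ∈ nbrs x.1 → |κ * A' x y| ≤ θ / ((ℓ + 1) ^ k : ℕ)) →
        0 ≤ θ' → (∀ (x z y : ↥(Box d ℓ k M)) (μ : Fin (d + 1)), z.1 = x.1 + e1 μ → y.1 = z.1 + e1 μ →
          |κ * (A' y z - A' z x)| ≤ θ' / (((ℓ + 1) ^ k : ℕ) : ℝ) ^ 2 ∧
          |κ * (A' x z - A' z y)| ≤ θ' / (((ℓ + 1) ^ k : ℕ) : ℝ) ^ 2) →
        (∀ (x y : ↥(Box d ℓ k M)) (μ : Fin (d + 1)), y.1 = x.1 + e1 μ →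
          (x.1 - e1 μ ∉ Box d ℓ k M ∨ y.1 + e1 μ ∉ Box d ℓ k M) → A' x y = 0 ∧ A' y x = 0) →
        ℓ₁ ^ 2 * θ ^ 2 * ((d : ℝ) + 1) * (1 + B1.aSeq a ((ℓ : ℝ) + 1) k * ((d : ℝ) + 1))
          ≤ min 2 (B1.aSeq a ((ℓ : ℝ) + 1) k) / 4 →
        ((d : ℝ) + 2) * c * (((d : ℝ) + 1) * ℓ₁ * (θ + θ') + ((d : ℝ) + 1) * ℓ₁ * θ
          + ((d : ℝ) + 1) * ℓ₁ ^ 2 * θ ^ 2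
          + B1.aSeq a ((ℓ : ℝ) + 1) k * (ℓ₁ * (((d : ℝ) + 1) * θ) * (2 + ℓ₁ * (((d : ℝ) + 1) * θ)))) ≤ 1 / 2 →
        ∀ f : ↥(Box d ℓ k M) × ι → ℝ,
          l1N (greenA d F κ ℓ k a m2 M (baseEmb hn M) (stairContour hn M) (constBond A₀ Subtype.val + A') *ᵥ f)
              + ∑ μ, l1N (derivA0 d F κ ℓ k M A₀ μ
                  *ᵥ (greenA d F κ ℓ k a m2 M (baseEmb hn M) (stairContour hn M) (constBond A₀ Subtype.val + A')
                      *ᵥ f))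
              ≤ 2 * (((d : ℝ) + 2) * c) * l1N f ∧
          (∀ μ : Fin (d + 1),
            l1N (derivA d F κ ℓ k M (constBond A₀ Subtype.val + A') μ
                *ᵥ (greenA d F κ ℓ k a m2 M (baseEmb hn M) (stairContour hn M) (constBond A₀ Subtype.val + A')
                    *ᵥ f))
              ≤ (1 + ℓ₁ * θ) * (2 * (((d : ℝ) + 2) * c)) * l1N f) ∧
          (∀ μ : Fin (d + 1),
            supN ((greenA d F κ ℓ k a m2 M (baseEmb hn M) (stairContour hn M) (constBond A₀ Subtype.val + A')
                * (derivA0 d F κ ℓ k M A₀ μ)ᵀ) *ᵥ f) ≤ 2 * (((d : ℝ) + 2) * c) * supN f) ∧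
          ∀ μ : Fin (d + 1),
            supN ((greenA d F κ ℓ k a m2 M (baseEmb hn M) (stairContour hn M) (constBond A₀ Subtype.val + A')
                * (derivA d F κ ℓ k M (constBond A₀ Subtype.val + A') μ)ᵀ) *ᵥ f)
              ≤ (1 + ℓ₁ * θ) * (2 * (((d : ℝ) + 2) * c)) * supN f := by
  obtain ⟨c, hc, h⟩ := lemma22_17_l1_box F hℓ₁ hLip κ d ℓ hℓ amin aplus m2plus ha
  refine ⟨c, hc, ?_⟩
  intro k hk hn a m2 e1' e2 e3 e4 M hM A₀ A' θ θ' hθ hA' hθ' hder hbd hsm2 hsm f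
  have hL : (1 : ℝ) < (ℓ : ℝ) + 1 := by
    have : (1 : ℝ) ≤ ℓ := by exact_mod_cast hℓ
    linarith
  have hak : 0 < B1.aSeq a ((ℓ : ℝ) + 1) k := B1.aSeq_pos (lt_of_lt_of_le ha e1') hL hk
  have hpos : 0 < min 2 (B1.aSeq a ((ℓ : ℝ) + 1) k) / 4 + m2 := by
    have : 0 < min 2 (B1.aSeq a ((ℓ : ℝ) + 1) k) := lt_min two_pos hak
    linarith
  have hAd : ∀ x y : ↥(Box d ℓ k M), y.1 ∈ nbrs x.1 →
      |κ * ((constBond A₀ Subtype.val + A' : ↥(Box d ℓ k M) → ↥(Box d ℓ k M) → ℝ) x y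
        - constBond A₀ Subtype.val x y)| ≤ θ / ((ℓ + 1) ^ k : ℕ) := by
    intro x y hxy
    simpa only [Pi.add_apply, add_sub_cancel_left] using hA' x y hxy
  have hunit := (green_box_l2_bound F hℓ₁ hLip κ hn hak.le hpos M A₀ (A := constBond A₀ Subtype.val + A') hθ hAd
    hsm2 0).1
  have hτ : ∀ y x, blkWt ((ℓ + 1) ^ k) M (fun i => (ℓ + 1) ^ k * M i) y x ≠ 0 →
      |κ * lsum A' (baseEmb hn M y) (stairContour hn M y x)| ≤ ((d : ℝ) + 1) * θ :=
    fun y x _ => stair_lsum_le κ hn M hθ hA' y x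
  have hτ0 : 0 ≤ ((d : ℝ) + 1) * θ := by positivity
  exact h k hk a m2 e1' e2 e3 e4 M hM (baseEmb hn M) (stairContour hn M) (fun y x hw => stairContour_end hn M y x hw)
    A₀ A' θ θ' (((d : ℝ) + 1) * θ) hunit hθ hA' hθ' hder hbd hτ0 hτ hsm f

end Assembly

end

end Literature.MathematicalPhysics.QuantumFieldTheory.Balaban1983to89.B4Lemma22L1Stair
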